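import Summits.QuantumAdvantage.QuantumAdvantage.Theorems.CertDialK
import HarnessLib

/-!
# CertDial — part L (§14a): THE NINE LIGHTS and their laws (weight `≤ 5` pages of the atlas)

§9's FIVE LIGHTS (part G) certify that no `r`-LOCAL answer map is perfect on the odd class at weight `≤ 3`; the antipodal strategies of
§10–§12 (parts H–J) win every odd-class input of weight `≤ 3`, so at weight 3 locality is essential.  §14 (parts L, M, N) is the weight-5
sequel.  Fix an even `M ≥ 2` with `2M + 2 ≤ n` (`n` even) and the five BLOCK POINTS `0, 1, M, 2M-1, 2M`, grouped into three CLUSTERS: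
LEFT `{0,1}`, MIDDLE `{M}`, RIGHT `{2M-1, 2M}`.  The NINE LIGHTS are the eight three-point inputs on the block other than `{0,1,M}` and
`{M,2M-1,2M}` (`lamp₁ … lamp₈`) together with the pent `pentIn n M = 1_{0,1,M,2M-1,2M}` of §13; all lie in the odd class, weight `≤ 5`
(`nine_lights_light`).  This part records their LAWS in plain coordinates — pages of the §8 atlas (`rel_tri_iff`, `rel_triAt_iff`,
`rel_mono_iff`) after locating each lamp as a two-one / monochromatic input (`lampₖ_eq_triAt`), plus the pent law `rel_pent_iff` (§13):
electorates `K₁ … K₉ ⊆ ℤ/n` with `Rel νₖ z ⟺ #{b ∈ Kₖ : z b = 1} ≡ tₖ (mod 2)` and target bits `t = (1,1,1,0,1,1,1,1,0)` — of ODD sum, which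
is what the certificate of part M (`nine_lights`) exploits.  Imports part K.  Nothing here touches the weight-7 leaves or 27432.
`lean check` on the tree closure: rc 0, no warnings, no placeholders; axioms standard (`propext`, `Classical.choice`, `Quot.sound`).
-/

set_option linter.dupNamespace false
set_option linter.style.longLine false

noncomputable section
open scoped Classical

namespace Summit.QuantumAdvantage.QuantumAdvantage.Theorems.CertDial
open Finset
open Literature.Computability.QuantumComplexity Literature.Computability.QuantumComplexity.RingHLF
open Summit.QuantumAdvantage.AdviceFreeQNC0
open Literature.Computability.MetaComplexity Literature.Computability.MetaComplexity.Smolensky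
open Summit.QuantumAdvantage.QuantumAdvantage.Theorems.ParityDial (par offs)

variable {n : ℕ}

/-! ### §14a The nine lights and their laws -/

/-- the three-point input `1_{a, c, e}`. -/
def trip (n a c e : ℕ) : Fin n → Bool := fun b => decide ((b : ℕ) = a ∨ (b : ℕ) = c ∨ (b : ℕ) = e)

/-- lamp 1 = `1_{0, 1, 2M-1}` (= `triAt 1 (2M-2) (n-1)`). -/
def lamp₁ (n M : ℕ) : Fin n → Bool := trip n 0 1 (2 * M - 1)

/-- lamp 2 = `1_{0, 1, 2M}` (= `triAt (2M) (n-2M) (n-2M+1)`). -/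
def lamp₂ (n M : ℕ) : Fin n → Bool := trip n 0 1 (2 * M)

/-- lamp 3 = `1_{0, M, 2M-1}` (= `tri n M (2M-1)`). -/
def lamp₃ (n M : ℕ) : Fin n → Bool := trip n 0 M (2 * M - 1)

/-- lamp 4 = `1_{0, M, 2M}` (monochromatic even). -/
def lamp₄ (n M : ℕ) : Fin n → Bool := trip n 0 M (2 * M)

/-- lamp 5 = `1_{0, 2M-1, 2M}` (= `triAt (2M) (n-2M) (n-1)`). -/
def lamp₅ (n M : ℕ) : Fin n → Bool := trip n 0 (2 * M - 1) (2 * M)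

/-- lamp 6 = `1_{1, M, 2M-1}` (= `triAt (2M-1) (n-2M+2) (n-M+1)`). -/
def lamp₆ (n M : ℕ) : Fin n → Bool := trip n 1 M (2 * M - 1)

/-- lamp 7 = `1_{1, M, 2M}` (= `triAt M M (n-M+1)`). -/
def lamp₇ (n M : ℕ) : Fin n → Bool := trip n 1 M (2 * M)

/-- lamp 8 = `1_{1, 2M-1, 2M}` (= `triAt 1 (2M-2) (2M-1)`). -/
def lamp₈ (n M : ℕ) : Fin n → Bool := trip n 1 (2 * M - 1) (2 * M)

/-- a three-point input with `a < c < e < n` has exactly three ones … -/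
theorem card_trip {a c e : ℕ} (hac : a < c) (hce : c < e) (hen : e < n) :
    (univ.filter fun b : Fin n => trip n a c e b = true).card = 3 := by
  have hset : (univ.filter fun b : Fin n => trip n a c e b = true) = {⟨a, by omega⟩, ⟨c, by omega⟩, ⟨e, hen⟩} := by
    ext b
    simp only [Finset.mem_filter, Finset.mem_univ, true_and, trip, decide_eq_true_eq, Finset.mem_insert, Finset.mem_singleton,
      Fin.ext_iff]
  rw [hset, Finset.card_insert_of_notMem (by simp [Fin.ext_iff]; omega), Finset.card_pair (by simp [Fin.ext_iff]; omega)]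

/-- … so it lies in the odd class for even `n` … -/
theorem oddZeros_trip (he : n % 2 = 0) {a c e : ℕ} (hac : a < c) (hce : c < e) (hen : e < n) : OddZeros (trip n a c e) := by
  unfold OddZeros
  have hc := Finset.card_filter_add_card_filter_not (s := (univ : Finset (Fin n))) (fun b : Fin n => trip n a c e b = true)
  rw [card_trip hac hce hen, Finset.card_univ, Fintype.card_fin] at hc
  rw [Finset.filter_congr fun b _ => show (trip n a c e b = false) ↔ ¬ (trip n a c e b = true) by simp]
  omega

/-- … and has weight `3`. -/
theorem wt_trip {a c e : ℕ} (hac : a < c) (hce : c < e) (hen : e < n) : LightDial.wt (trip n a c e) = 3 := by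
  unfold LightDial.wt; exact card_trip hac hce hen

/-- the pent input has weight `5`. -/
theorem wt_pentIn {M : ℕ} (hM : 2 ≤ M) (hMn : 2 * M < n) : LightDial.wt (pentIn n M) = 5 := by
  unfold LightDial.wt; exact card_pentIn hM hMn

/-- lamp 1 as a two-one input at `1`. -/
theorem lamp₁_eq_triAt {M : ℕ} (hM : 2 ≤ M) (hMn : 2 * M + 2 ≤ n) :
    lamp₁ n M = triAt (⟨1, by omega⟩ : Fin n) (2 * M - 2) (n - 1) := by
  funext b; have hb := b.isLt
  simp only [lamp₁, trip, triAt, offs, decide_eq_decide]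
  split_ifs <;> omega

/-- lamp 2 as a two-one input at `2M`. -/
theorem lamp₂_eq_triAt {M : ℕ} (hM : 2 ≤ M) (hMn : 2 * M + 2 ≤ n) :
    lamp₂ n M = triAt (⟨2 * M, by omega⟩ : Fin n) (n - 2 * M) (n - 2 * M + 1) := by
  funext b; have hb := b.isLt
  simp only [lamp₂, trip, triAt, offs, decide_eq_decide]
  split_ifs <;> omega

/-- lamp 5 as a two-one input at `2M`. -/
theorem lamp₅_eq_triAt {M : ℕ} (hM : 2 ≤ M) (hMn : 2 * M + 2 ≤ n) :
    lamp₅ n M = triAt (⟨2 * M, by omega⟩ : Fin n) (n - 2 * M) (n - 1) := by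
  funext b; have hb := b.isLt
  simp only [lamp₅, trip, triAt, offs, decide_eq_decide]
  split_ifs <;> omega

/-- lamp 6 as a two-one input at `2M-1`. -/
theorem lamp₆_eq_triAt {M : ℕ} (hM : 2 ≤ M) (hMn : 2 * M + 2 ≤ n) :
    lamp₆ n M = triAt (⟨2 * M - 1, by omega⟩ : Fin n) (n - 2 * M + 2) (n - M + 1) := by
  funext b; have hb := b.isLt
  simp only [lamp₆, trip, triAt, offs, decide_eq_decide]
  split_ifs <;> omega

/-- lamp 7 as a two-one input at `M`. -/
theorem lamp₇_eq_triAt {M : ℕ} (hM : 2 ≤ M) (hMn : 2 * M + 2 ≤ n) :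
    lamp₇ n M = triAt (⟨M, by omega⟩ : Fin n) M (n - M + 1) := by
  funext b; have hb := b.isLt
  simp only [lamp₇, trip, triAt, offs, decide_eq_decide]
  split_ifs <;> omega

/-- lamp 8 as a two-one input at `1`. -/
theorem lamp₈_eq_triAt {M : ℕ} (hM : 2 ≤ M) (hMn : 2 * M + 2 ≤ n) :
    lamp₈ n M = triAt (⟨1, by omega⟩ : Fin n) (2 * M - 2) (2 * M - 1) := by
  funext b; have hb := b.isLt
  simp only [lamp₈, trip, triAt, offs, decide_eq_decide]
  split_ifs <;> omega

/-- LAW 1: `Rel (lamp₁) z ⟺ #{b : (b odd ∨ 1 ≤ b ≤ 2M-2), z b}` odd. -/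
theorem rel_lamp₁_iff (he : n % 2 = 0) {M : ℕ} (hM : 2 ≤ M) (hMn : 2 * M + 2 ≤ n) (z : Fin n → Bool) :
    Rel (lamp₁ n M) z ↔
      (univ.filter fun b : Fin n => ((b : ℕ) % 2 = 1 ∨ (1 ≤ (b : ℕ) ∧ (b : ℕ) ≤ 2 * M - 2)) ∧ z b = true).card % 2 = 1 := by
  rw [lamp₁_eq_triAt hM hMn, rel_triAt_iff he (by omega) _ (by omega) (by omega) (by omega) (by omega) (by omega) z]
  rw [Finset.filter_congr fun (b : Fin n) _ => show
      ((offs b (⟨1, by omega⟩ : Fin n) % 2 = 0 ∨ offs b (⟨1, by omega⟩ : Fin n) < 2 * M - 2) ∧ z b = true) ↔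
      (((b : ℕ) % 2 = 1 ∨ (1 ≤ (b : ℕ) ∧ (b : ℕ) ≤ 2 * M - 2)) ∧ z b = true) by
    have hb := b.isLt
    simp only [offs]
    constructor
    · rintro ⟨h, hz⟩; refine ⟨?_, hz⟩; split_ifs at h <;> omega
    · rintro ⟨h, hz⟩; refine ⟨?_, hz⟩; split_ifs <;> omega]

/-- LAW 2: `Rel (lamp₂) z ⟺ #{b : (b even ∨ 2M ≤ b), z b}` odd. -/
theorem rel_lamp₂_iff (he : n % 2 = 0) {M : ℕ} (hM2 : M % 2 = 0) (hM : 2 ≤ M) (hMn : 2 * M + 2 ≤ n) (z : Fin n → Bool) :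
    Rel (lamp₂ n M) z ↔ (univ.filter fun b : Fin n => ((b : ℕ) % 2 = 0 ∨ 2 * M ≤ (b : ℕ)) ∧ z b = true).card % 2 = 1 := by
  rw [lamp₂_eq_triAt hM hMn, rel_triAt_iff he (by omega) _ (by omega) (by omega) (by omega) (by omega) (by omega) z]
  rw [Finset.filter_congr fun (b : Fin n) _ => show
      ((offs b (⟨2 * M, by omega⟩ : Fin n) % 2 = 0 ∨ offs b (⟨2 * M, by omega⟩ : Fin n) < n - 2 * M) ∧ z b = true) ↔
      (((b : ℕ) % 2 = 0 ∨ 2 * M ≤ (b : ℕ)) ∧ z b = true) by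
    have hb := b.isLt
    simp only [offs]
    constructor
    · rintro ⟨h, hz⟩; refine ⟨?_, hz⟩; split_ifs at h <;> omega
    · rintro ⟨h, hz⟩; refine ⟨?_, hz⟩; split_ifs <;> omega]

/-- LAW 3: `Rel (lamp₃) z ⟺ #{b : (b even ∨ b < M), z b}` odd. -/
theorem rel_lamp₃_iff (he : n % 2 = 0) {M : ℕ} (hM2 : M % 2 = 0) (hM : 2 ≤ M) (hMn : 2 * M + 2 ≤ n) (z : Fin n → Bool) :
    Rel (lamp₃ n M) z ↔ (univ.filter fun b : Fin n => ((b : ℕ) % 2 = 0 ∨ (b : ℕ) < M) ∧ z b = true).card % 2 = 1 :=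
  rel_tri_iff he (by omega) hM2 (by omega) hM (by omega) (by omega) z

/-- LAW 4: `Rel (lamp₄) z ⟺ #{b odd : z b}` even. -/
theorem rel_lamp₄_iff (he : n % 2 = 0) {M : ℕ} (hM2 : M % 2 = 0) (hM : 2 ≤ M) (hMn : 2 * M + 2 ≤ n) (z : Fin n → Bool) :
    Rel (lamp₄ n M) z ↔ (univ.filter fun b : Fin n => (b : ℕ) % 2 = 1 ∧ z b = true).card % 2 = 0 := by
  have hx : OddZeros (lamp₄ n M) := oddZeros_trip he (by omega) (by omega) (by omega)
  have hq : ∀ b, lamp₄ n M b = true → par b = true := by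
    intro b hb; simp only [lamp₄, trip, decide_eq_true_eq] at hb; simp only [par, decide_eq_true_eq]; omega
  rw [rel_mono_iff he (by omega) hx hq z]
  rw [Finset.filter_congr fun (b : Fin n) _ => show (par b ≠ true ∧ z b = true) ↔ ((b : ℕ) % 2 = 1 ∧ z b = true) by
    simp only [par, ne_eq, decide_eq_true_eq]; constructor <;> rintro ⟨h, hz⟩ <;> exact ⟨by omega, hz⟩]

/-- LAW 5: `Rel (lamp₅) z ⟺ #{b : (b even ∨ 2M ≤ b), z b}` odd (same electorate as lamp 2). -/
theorem rel_lamp₅_iff (he : n % 2 = 0) {M : ℕ} (hM2 : M % 2 = 0) (hM : 2 ≤ M) (hMn : 2 * M + 2 ≤ n) (z : Fin n → Bool) :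
    Rel (lamp₅ n M) z ↔ (univ.filter fun b : Fin n => ((b : ℕ) % 2 = 0 ∨ 2 * M ≤ (b : ℕ)) ∧ z b = true).card % 2 = 1 := by
  rw [lamp₅_eq_triAt hM hMn, rel_triAt_iff he (by omega) _ (by omega) (by omega) (by omega) (by omega) (by omega) z]
  rw [Finset.filter_congr fun (b : Fin n) _ => show
      ((offs b (⟨2 * M, by omega⟩ : Fin n) % 2 = 0 ∨ offs b (⟨2 * M, by omega⟩ : Fin n) < n - 2 * M) ∧ z b = true) ↔
      (((b : ℕ) % 2 = 0 ∨ 2 * M ≤ (b : ℕ)) ∧ z b = true) by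
    have hb := b.isLt
    simp only [offs]
    constructor
    · rintro ⟨h, hz⟩; refine ⟨?_, hz⟩; split_ifs at h <;> omega
    · rintro ⟨h, hz⟩; refine ⟨?_, hz⟩; split_ifs <;> omega]

/-- LAW 6: `Rel (lamp₆) z ⟺ #{b : (b odd ∨ 2M-1 ≤ b ∨ b = 0), z b}` odd. -/
theorem rel_lamp₆_iff (he : n % 2 = 0) {M : ℕ} (hM2 : M % 2 = 0) (hM : 2 ≤ M) (hMn : 2 * M + 2 ≤ n) (z : Fin n → Bool) :
    Rel (lamp₆ n M) z ↔
      (univ.filter fun b : Fin n => ((b : ℕ) % 2 = 1 ∨ 2 * M - 1 ≤ (b : ℕ) ∨ (b : ℕ) = 0) ∧ z b = true).card % 2 = 1 := by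
  rw [lamp₆_eq_triAt hM hMn, rel_triAt_iff he (by omega) _ (by omega) (by omega) (by omega) (by omega) (by omega) z]
  rw [Finset.filter_congr fun (b : Fin n) _ => show
      ((offs b (⟨2 * M - 1, by omega⟩ : Fin n) % 2 = 0 ∨ offs b (⟨2 * M - 1, by omega⟩ : Fin n) < n - 2 * M + 2) ∧ z b = true) ↔
      (((b : ℕ) % 2 = 1 ∨ 2 * M - 1 ≤ (b : ℕ) ∨ (b : ℕ) = 0) ∧ z b = true) by
    have hb := b.isLt
    simp only [offs]
    constructor
    · rintro ⟨h, hz⟩; refine ⟨?_, hz⟩; split_ifs at h <;> omega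
    · rintro ⟨h, hz⟩; refine ⟨?_, hz⟩; split_ifs <;> omega]

/-- LAW 7: `Rel (lamp₇) z ⟺ #{b : (b even ∨ M ≤ b < 2M), z b}` odd. -/
theorem rel_lamp₇_iff (he : n % 2 = 0) {M : ℕ} (hM2 : M % 2 = 0) (hM : 2 ≤ M) (hMn : 2 * M + 2 ≤ n) (z : Fin n → Bool) :
    Rel (lamp₇ n M) z ↔
      (univ.filter fun b : Fin n => ((b : ℕ) % 2 = 0 ∨ (M ≤ (b : ℕ) ∧ (b : ℕ) < 2 * M)) ∧ z b = true).card % 2 = 1 := by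
  rw [lamp₇_eq_triAt hM hMn, rel_triAt_iff he (by omega) _ (by omega) (by omega) (by omega) (by omega) (by omega) z]
  rw [Finset.filter_congr fun (b : Fin n) _ => show
      ((offs b (⟨M, by omega⟩ : Fin n) % 2 = 0 ∨ offs b (⟨M, by omega⟩ : Fin n) < M) ∧ z b = true) ↔
      (((b : ℕ) % 2 = 0 ∨ (M ≤ (b : ℕ) ∧ (b : ℕ) < 2 * M)) ∧ z b = true) by
    have hb := b.isLt
    simp only [offs]
    constructor
    · rintro ⟨h, hz⟩; refine ⟨?_, hz⟩; split_ifs at h <;> omega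
    · rintro ⟨h, hz⟩; refine ⟨?_, hz⟩; split_ifs <;> omega]

/-- LAW 8: `Rel (lamp₈) z ⟺ #{b : (b odd ∨ 1 ≤ b ≤ 2M-2), z b}` odd (same electorate as lamp 1). -/
theorem rel_lamp₈_iff (he : n % 2 = 0) {M : ℕ} (hM : 2 ≤ M) (hMn : 2 * M + 2 ≤ n) (z : Fin n → Bool) :
    Rel (lamp₈ n M) z ↔
      (univ.filter fun b : Fin n => ((b : ℕ) % 2 = 1 ∨ (1 ≤ (b : ℕ) ∧ (b : ℕ) ≤ 2 * M - 2)) ∧ z b = true).card % 2 = 1 := by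
  rw [lamp₈_eq_triAt hM hMn, rel_triAt_iff he (by omega) _ (by omega) (by omega) (by omega) (by omega) (by omega) z]
  rw [Finset.filter_congr fun (b : Fin n) _ => show
      ((offs b (⟨1, by omega⟩ : Fin n) % 2 = 0 ∨ offs b (⟨1, by omega⟩ : Fin n) < 2 * M - 2) ∧ z b = true) ↔
      (((b : ℕ) % 2 = 1 ∨ (1 ≤ (b : ℕ) ∧ (b : ℕ) ≤ 2 * M - 2)) ∧ z b = true) by
    have hb := b.isLt
    simp only [offs]
    constructor
    · rintro ⟨h, hz⟩; refine ⟨?_, hz⟩; split_ifs at h <;> omega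
    · rintro ⟨h, hz⟩; refine ⟨?_, hz⟩; split_ifs <;> omega]

/-- all nine lights lie in the odd class and have weight `≤ 5`. -/
theorem nine_lights_light (he : n % 2 = 0) {M : ℕ} (hM : 2 ≤ M) (hMn : 2 * M + 2 ≤ n) :
    (OddZeros (lamp₁ n M) ∧ LightDial.wt (lamp₁ n M) ≤ 5) ∧ (OddZeros (lamp₂ n M) ∧ LightDial.wt (lamp₂ n M) ≤ 5) ∧
    (OddZeros (lamp₃ n M) ∧ LightDial.wt (lamp₃ n M) ≤ 5) ∧ (OddZeros (lamp₄ n M) ∧ LightDial.wt (lamp₄ n M) ≤ 5) ∧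
    (OddZeros (lamp₅ n M) ∧ LightDial.wt (lamp₅ n M) ≤ 5) ∧ (OddZeros (lamp₆ n M) ∧ LightDial.wt (lamp₆ n M) ≤ 5) ∧
    (OddZeros (lamp₇ n M) ∧ LightDial.wt (lamp₇ n M) ≤ 5) ∧ (OddZeros (lamp₈ n M) ∧ LightDial.wt (lamp₈ n M) ≤ 5) ∧
    (OddZeros (pentIn n M) ∧ LightDial.wt (pentIn n M) ≤ 5) := by
  refine ⟨⟨oddZeros_trip he (by omega) (by omega) (by omega), (wt_trip (n := n) (by omega) (by omega) (by omega)).le.trans (by omega)⟩,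
    ⟨oddZeros_trip he (by omega) (by omega) (by omega), (wt_trip (n := n) (by omega) (by omega) (by omega)).le.trans (by omega)⟩,
    ⟨oddZeros_trip he (by omega) (by omega) (by omega), (wt_trip (n := n) (by omega) (by omega) (by omega)).le.trans (by omega)⟩,
    ⟨oddZeros_trip he (by omega) (by omega) (by omega), (wt_trip (n := n) (by omega) (by omega) (by omega)).le.trans (by omega)⟩,
    ⟨oddZeros_trip he (by omega) (by omega) (by omega), (wt_trip (n := n) (by omega) (by omega) (by omega)).le.trans (by omega)⟩,
    ⟨oddZeros_trip he (by omega) (by omega) (by omega), (wt_trip (n := n) (by omega) (by omega) (by omega)).le.trans (by omega)⟩,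
    ⟨oddZeros_trip he (by omega) (by omega) (by omega), (wt_trip (n := n) (by omega) (by omega) (by omega)).le.trans (by omega)⟩,
    ⟨oddZeros_trip he (by omega) (by omega) (by omega), (wt_trip (n := n) (by omega) (by omega) (by omega)).le.trans (by omega)⟩,
    ⟨oddZeros_pentIn he hM (by omega), (wt_pentIn hM (by omega)).le⟩⟩

/-! ### Axiom audit -/

/-- info: 'Summit.QuantumAdvantage.QuantumAdvantage.Theorems.CertDial.rel_lamp₆_iff' depends on axioms: [propext,
 Classical.choice,
 Quot.sound] -/
#guard_msgs in #print axioms rel_lamp₆_iff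

/-- info: 'Summit.QuantumAdvantage.QuantumAdvantage.Theorems.CertDial.nine_lights_light' depends on axioms: [propext,
 Classical.choice,
 Quot.sound] -/
#guard_msgs in #print axioms nine_lights_light

end Summit.QuantumAdvantage.QuantumAdvantage.Theorems.CertDial
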